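import Literature.MathematicalPhysics.QuantumLattice.HeisenbergAFInfiniteVolumeGroundState
import Literature.MathematicalPhysics.QuantumLattice.EnergyEntropyBalance
import HarnessLib

/-!
# The infinitesimal-field thermal states of the Heisenberg antiferromagnet on `ℤ^d` are
# energy–entropy-balance (differential KMS) states — and for `d ≥ 3` there are two of them

Koma–Tasaki, Commun. Math. Phys. **158** (1993) 191–214, §1 (1.8): the infinite-volume equilibrium state with an
infinitesimal symmetry-breaking field, `ω̃ = lim_{B↓0} lim_{Λ↑ℤ^d} Tr[(·)e^{-β(H_Λ - BO_Λ)}]/Tr[⋯]`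
(`XXZKT.IsInfinitesimalFieldThermalState`, `XXZAntiferromagnetInfiniteVolumeOrder.lean`, realised along even tori and
subsequences).  What makes a state of the INFINITE system an equilibrium state at inverse temperature `β` for the
Heisenberg dynamics is the KMS condition, equivalently (Bratteli–Robinson II Thm. 5.3.15 = Araki–Sewell / Roepstorff;
Araki–Moriya 2003 Def. 6.3 "differential KMS"; Fawzi–Fawzi–Scalet 2024 Thm. 3.1) the **energy–entropy balance
inequalities**: for every local `A`, with `δ(A) = i[H_{Λ_1}, A]` the generator (tree: `derivation Φ 1 Λ A`),
`(C-1)` `ω(A⋆δA)` is purely imaginary and `(C-2)` `ω(A⋆A) log(ω(A⋆A)/ω(AA⋆)) ≤ −iβ ω(A⋆δA)`.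

The tree PROVES `(C-1)`, `(C-2)` and their linear "tangent" form `θ ω(A⋆A) − e^{θ−1} ω(AA⋆) ≤ β ω(A⋆[H,A])`
(`θ ∈ ℝ`) for the Gibbs state of every Hermitian MATRIX (`Matrix.IsHermitian.eeb_tangent_le`, `….eeb_le`,
`….im_gibbsState_conjTranspose_mul_commutator`, `Matrix.gibbsState_commutator_eq_zero`; `EnergyEntropyBalance.lean`),
and has the abstract predicate `State.IsDKMSState` for `C⋆`-dynamical systems.  This file

* defines the lattice-local form `InfVolState.IsDKMSState ω Φ R β` of Araki–Moriya's Def. 6.3 for a finite-range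
  interaction `Φ` on the quantum spin system over `ℤ^d` — the three clauses of `State.IsDKMSState` with `a = A ⊗ 𝟙`,
  `δa = derivation Φ R Λ A`, computed in `𝔄_{Λ_R}` exactly as the tree's ground-state condition
  `InfVolState.IsGroundState` (its formal `β = +∞` case) does;
* PROVES that every infinitesimal-field thermal state `ω̃` of the Heisenberg antiferromagnet (`Δ = 1`, any `d`, `n`, `J`,
  any source direction `α`, any real `β`) satisfies, for the nearest-neighbour Heisenberg interaction
  `heisenbergLatticeInteraction d n J` (`HeisenbergAFInfiniteVolumeGroundState.lean`):
  the tangent EEB rows (`XXZKT.IsInfinitesimalFieldThermalState.eeb_tangent_le`), the EEB inequality `(C-2)` with its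
  `+∞`-clause (`….eeb_le`), reality `(C-1)` (`….im_expect_conjTranspose_mul_commutator_eq_zero`), the stationarity rows
  `ω̃([H_{Λ_1}, Ã]) = 0` (`….expect_commutator_eq_zero`), hence `ω̃.IsDKMSState (heisenbergLatticeInteraction d n J) 1 β`
  (`….isDKMSState`);
* PROVES that the state sourced along `S^y` has vanishing `S^x` one-point function (`….expect_siteSpinAt_zero_eq_zero`,
  the half-turn about the `y`-axis fixes `H − BO^y` and reverses `S^x`);
* CONCLUDES, with Dyson–Lieb–Simon / Kennedy–Lieb–Shastry long-range order in the form of the tree's infinite-volume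
  floor `(-1)^x Re ω̃(S^x_x) ≥ √3σ > 0` (`heisenbergAF_infiniteVolume_spontaneousStaggeredMagnetisation`): for `d ≥ 3`,
  `S = n/2 ≥ ½`, `J > 0` there is `β₀` such that for every `β ≥ β₀` the Heisenberg antiferromagnet on `ℤ^d` has a dKMS
  state at `β` with Néel order at every site (`XXZKT.heisenbergAF_exists_dKMSState_neelOrder`) and AT LEAST TWO distinct
  dKMS states at `β` (`XXZKT.heisenbergAF_dKMSState_not_unique`) — the low-temperature phase transition of the quantum
  Heisenberg antiferromagnet in `d ≥ 3` at the level of the energy–entropy-balance characterisation of equilibrium.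

Proof of the rows (the thermal twin of `IsInfinitesimalFieldGroundState.isGroundState`).  On a large even torus with
sourced Hamiltonian `K_L = H_L − BO_L` and `X = Γ(Ã)`: `XᴴX = Γ(ÃᴴÃ)`, `XXᴴ = Γ(ÃÃᴴ)`, and by torus locality of the
Heisenberg Hamiltonian (`heisenbergTorus_commutator_spinEmbed`) and of the source (`stagSpin_comm_spinEmbed`)
`[K_L, X] = Γ([H_{Λ_1}, Ã]) − B·Γ(D₀)` for a FIXED local `D₀ ∈ 𝔄_{Λ_1}` (`sourcedAF_commutator_spinEmbed`).  Every
finite-volume row for `⟨·⟩_{β,K_L}` is therefore an inequality `Re t(ΓP) ≤ Re t(ΓQ) − B·Re t(ΓD)` between torus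
expectations of fixed local observables; it passes to the torus limit at fixed `B`, and then to `B_m ↓ 0` because
`|ω_m(D)| ≤ ‖D‖` (`IsInfinitesimalFieldThermalState.re_expect_le_of_torus_rows`).

WHAT THIS IS NOT: the KMS condition proper (boundary values of `t ↦ ω(A τ_t(B))` on the strip) for the
`C⋆`-dynamics of the quasi-local algebra is not formalised, nor is the equivalence dKMS ⟺ KMS (Araki–Moriya
Thm. 6.4 / Bratteli–Robinson II Thm. 5.3.15 — cited); nothing here concerns the Hubbard model.

## References
* [KomaTasaki1993] T. Koma, H. Tasaki, CMP **158** (1993), §1 (1.5), (1.8)–(1.10), Corollary 1.1; §2 (2.3), (2.5).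
* [ArakiMoriya2003] H. Araki, H. Moriya, Rev. Math. Phys. 15 (2003) 93, Def. 6.3 (C-1), (C-2); Thm. 6.4.
* [BratteliRobinsonII1997] O. Bratteli, D. W. Robinson, *OAQSM 2*, Thm. 5.3.15 (EEB ⟺ KMS), §6.2.1–6.2.2.
* [FawziFawziScalet2024] H. Fawzi, O. Fawzi, S. O. Scalet, Nat. Commun. 15 (2024) 7394 = arXiv:2311.18706,
  §3.1 Thm. 3.1 (4)–(5).
* [DLS1978] F. J. Dyson, E. H. Lieb, B. Simon, J. Stat. Phys. **18** (1978) 335–383, Thm. 5.1/6.x (Néel order, `d ≥ 3`).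
* [KennedyLiebShastryJSP1988] T. Kennedy, E. H. Lieb, B. S. Shastry, J. Stat. Phys. **53** (1988) 1019.
-/

noncomputable section

namespace Literature.MathematicalPhysics.QuantumLattice

open Matrix Finset _root_.Filter Literature.Probability.LatticeModels
  Literature.MathematicalPhysics.QuantumLattice.SpinOperators
open scoped _root_.Topology ComplexOrder

variable {d : ℕ}

/-! ### Differential KMS (energy–entropy balance) states of a lattice interaction -/

namespace InfVolState

variable {q : ℕ}

/-- `ω` is a **differential `β`-KMS state** (energy–entropy-balance state) of the finite-range interaction `Φ`
(range `R`): Araki–Moriya's Def. 6.3 in the lattice-local form of `InfVolState.IsGroundState` — for every finite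
`Λ ⊂ ℤ^d` and `A ∈ 𝔄_Λ`, with `Ã = A ⊗ 𝟙 ∈ 𝔄_{Λ_R}` and `δA = derivation Φ R Λ A = i[H_{Λ_R}, Ã]`:
`(C-1)` `Re ω(Ãᴴ δA) = 0` (`ω(A⋆δA)` is purely imaginary); the `+∞`-clause `0 < Re ω(AᴴA) → 0 < Re ω(AAᴴ)`;
`(C-2)` `Re ω(AᴴA) · log(Re ω(AᴴA)/Re ω(AAᴴ)) ≤ β · Re(−i ω(Ãᴴ δA))` (`= β ω(Ãᴴ[H_{Λ_R}, Ã])`).  Lean's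
`Real.log 0 = 0`, `x/0 = 0` make the left side of `(C-2)` vanish when either moment does, whence the separate
`+∞`-clause (as in the abstract `State.IsDKMSState`, whose content this is for the quasi-local dynamics generated by
`Φ`).  For `β > 0` these states are exactly the `(τ, β)`-KMS states (Araki–Moriya Thm. 6.4, Bratteli–Robinson II
Thm. 5.3.15 — not formalised). [cite: ArakiMoriya2003, Def 6.3] [cite: BratteliRobinsonII1997, Thm. 5.3.15] -/
def IsDKMSState (ω : InfVolState d q) (Φ : LatticeInteraction d q) (R β : ℝ) : Prop :=
  ∀ (Λ : Finset (Site d)) (A : Op ↥Λ q),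
    (ω.expect (thicken Λ R) ((embedOp (subset_thicken Λ R) A)ᴴ * derivation Φ R Λ A)).re = 0 ∧
    (0 < (ω.expect Λ (Aᴴ * A)).re → 0 < (ω.expect Λ (A * Aᴴ)).re) ∧
    (ω.expect Λ (Aᴴ * A)).re * Real.log ((ω.expect Λ (Aᴴ * A)).re / (ω.expect Λ (A * Aᴴ)).re) ≤
      β * (-Complex.I * ω.expect (thicken Λ R) ((embedOp (subset_thicken Λ R) A)ᴴ * derivation Φ R Λ A)).re

variable {ω : InfVolState d q} {Φ : LatticeInteraction d q} {R β : ℝ}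

/-- `(C-1)` of a dKMS state. [cite: ArakiMoriya2003, Def 6.3 (C-1)] -/
theorem IsDKMSState.re_expect_conjTranspose_mul_derivation (h : ω.IsDKMSState Φ R β) (Λ : Finset (Site d))
    (A : Op ↥Λ q) : (ω.expect (thicken Λ R) ((embedOp (subset_thicken Λ R) A)ᴴ * derivation Φ R Λ A)).re = 0 :=
  (h Λ A).1

/-- The `+∞`-clause of `(C-2)`: `ω(AᴴA) > 0 ⇒ ω(AAᴴ) > 0`. [cite: ArakiMoriya2003, Def 6.3 (C-2)] -/
theorem IsDKMSState.re_pos_of_re_pos (h : ω.IsDKMSState Φ R β) (Λ : Finset (Site d)) (A : Op ↥Λ q)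
    (hA : 0 < (ω.expect Λ (Aᴴ * A)).re) : 0 < (ω.expect Λ (A * Aᴴ)).re :=
  (h Λ A).2.1 hA

/-- `(C-2)` of a dKMS state (finite part). [cite: ArakiMoriya2003, Def 6.3 (C-2)] -/
theorem IsDKMSState.mul_log_div_le (h : ω.IsDKMSState Φ R β) (Λ : Finset (Site d)) (A : Op ↥Λ q) :
    (ω.expect Λ (Aᴴ * A)).re * Real.log ((ω.expect Λ (Aᴴ * A)).re / (ω.expect Λ (A * Aᴴ)).re) ≤
      β * (-Complex.I * ω.expect (thicken Λ R) ((embedOp (subset_thicken Λ R) A)ᴴ * derivation Φ R Λ A)).re :=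
  (h Λ A).2.2

/-- **The tangent (linear) EEB rows of a dKMS state**: for every local `A` and real `θ`,
`θ·Re ω(AᴴA) − e^{θ−1}·Re ω(AAᴴ) ≤ β·Re(−i ω(Ãᴴ δA))` (supporting lines of the convex constraint `(C-2)`,
`mul_sub_exp_mul_le_mul_log_div`). [cite: ArakiMoriya2003, Def 6.3 (C-2)] [cite: FawziFawziScalet2024, Thm. 3.1 (5)] -/
theorem IsDKMSState.tangent_le (h : ω.IsDKMSState Φ R β) (Λ : Finset (Site d)) (A : Op ↥Λ q) (θ : ℝ) :
    θ * (ω.expect Λ (Aᴴ * A)).re - Real.exp (θ - 1) * (ω.expect Λ (A * Aᴴ)).re ≤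
      β * (-Complex.I * ω.expect (thicken Λ R) ((embedOp (subset_thicken Λ R) A)ᴴ * derivation Φ R Λ A)).re := by
  obtain ⟨-, h2, h3⟩ := h Λ A
  have hx : 0 ≤ (ω.expect Λ (Aᴴ * A)).re := (Complex.nonneg_iff.1 (ω.expect_nonneg Λ A)).1
  have hy : 0 ≤ (ω.expect Λ (A * Aᴴ)).re := by
    have := ω.expect_nonneg Λ Aᴴ
    rw [conjTranspose_conjTranspose] at this
    exact (Complex.nonneg_iff.1 this).1
  rcases hx.eq_or_lt with hx0 | hxpos
  · rw [← hx0] at h3 ⊢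
    have h0 : (0 : ℝ) ≤ β * (-Complex.I *
        ω.expect (thicken Λ R) ((embedOp (subset_thicken Λ R) A)ᴴ * derivation Φ R Λ A)).re := by simpa using h3
    nlinarith [mul_nonneg (Real.exp_pos (θ - 1)).le hy]
  · exact (mul_sub_exp_mul_le_mul_log_div hx (h2 hxpos) θ).trans h3

end InfVolState

namespace XXZKT

/-! ### Finite volume: the sourced generator is local on the torus; the `y`-sourced state has no `x`-moment -/

section Torus

variable {L : ℕ} [NeZero L] (n : ℕ)

/-- `H_L = K_L(B) + B·O^α_L` at `Δ = 1` (the Heisenberg torus Hamiltonian is the sourced Hamiltonian plus the source).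
[cite: KomaTasaki1993, §1 (1.8)] -/
theorem heisenbergHamiltonian_eq_sourcedAF_add (J : ℝ) (α : Fin 3) (B : ℝ) :
    heisenbergHamiltonian n (torusGraph d L) J =
      sourcedAF d L n J 1 α B + (B : ℂ) • stagSpin n (torusParityExp d L) α := by
  rw [sourcedAF, xxzHamiltonian_at_one, sub_add_cancel]

variable {n} in
/-- **Torus locality of the sourced generator**: for `A ∈ 𝔄_Λ`, `Λ_1 = thicken Λ 1` pulled injectively into the even
torus and `X = Γ(A ⊗ 𝟙)`, the commutator with the SOURCED Hamiltonian is the image of fixed local observables: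
`K_L X − X K_L = Γ([H_{Λ_1}, Ã]) − B·Γ(Σ_{y ∈ Λ_1} (-1)^y [S^α_y, Ã])`.
[cite: BratteliRobinsonII1997, §6.2.1 (local commutativity)] [cite: KomaTasaki1993, §1 (1.8)] -/
theorem sourcedAF_commutator_spinEmbed (hL : Even L) (J : ℝ) (α : Fin 3) (B : ℝ) {Λ : Finset (Site d)}
    (h' : Set.InjOn (Torus.proj (d := d) L) ↑(thicken Λ 1)) (A : Op ↥Λ (n + 1)) :
    sourcedAF d L n J 1 α B * spinEmbed (spinToTorusEmb L h') (embedOp (subset_thicken Λ 1) A) -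
        spinEmbed (spinToTorusEmb L h') (embedOp (subset_thicken Λ 1) A) * sourcedAF d L n J 1 α B =
      spinEmbed (spinToTorusEmb L h')
          (localHamiltonian ((heisenbergLatticeInteraction d n J).restrict (thicken Λ 1)) univ *
              embedOp (subset_thicken Λ 1) A -
            embedOp (subset_thicken Λ 1) A *
              localHamiltonian ((heisenbergLatticeInteraction d n J).restrict (thicken Λ 1)) univ) -
        (B : ℂ) • spinEmbed (spinToTorusEmb L h')
          (∑ y : ↥(thicken Λ 1), (latticeStagger (y : Site d) : ℂ) •
            (siteSpin n y α * embedOp (subset_thicken Λ 1) A - embedOp (subset_thicken Λ 1) A * siteSpin n y α)) := by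
  set X := spinEmbed (spinToTorusEmb L h') (embedOp (subset_thicken Λ 1) A) with hX
  have hH : heisenbergHamiltonian n (torusGraph d L) J * X - X * heisenbergHamiltonian n (torusGraph d L) J =
      spinEmbed (spinToTorusEmb L h')
        (localHamiltonian ((heisenbergLatticeInteraction d n J).restrict (thicken Λ 1)) univ *
            embedOp (subset_thicken Λ 1) A -
          embedOp (subset_thicken Λ 1) A *
            localHamiltonian ((heisenbergLatticeInteraction d n J).restrict (thicken Λ 1)) univ) := by
    rw [hX, ← spinEmbed_siteIncl_eq_embedOp, localHamiltonian_heisenbergLatticeInteraction_eq_windowGraph]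
    exact heisenbergTorus_commutator_spinEmbed n J (subset_thicken Λ 1)
      (fun x hx i => add_sub_unitVec_mem_thicken_one hx i) h' A
  have hO : stagSpin n (torusParityExp d L) α * X - X * stagSpin n (torusParityExp d L) α =
      spinEmbed (spinToTorusEmb L h')
        (∑ y : ↥(thicken Λ 1), (latticeStagger (y : Site d) : ℂ) •
          (siteSpin n y α * embedOp (subset_thicken Λ 1) A - embedOp (subset_thicken Λ 1) A * siteSpin n y α)) := by
    rw [hX, stagSpin_comm_spinEmbed n]
    congr 1
    refine Finset.sum_congr rfl fun y _ => ?_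
    rw [spinToTorusEmb_apply, stagSign_torusParityExp_proj hL]
  have hK : sourcedAF d L n J 1 α B =
      heisenbergHamiltonian n (torusGraph d L) J - (B : ℂ) • stagSpin n (torusParityExp d L) α := by
    rw [sourcedAF, xxzHamiltonian_at_one]
  rw [hK, Matrix.sub_mul, Matrix.mul_sub, Matrix.smul_mul, Matrix.mul_smul, ← hH, ← hO, smul_sub]
  abel

/-- The half turn about the `y`-axis FIXES the staggered `y`-spin: `U O^y Uᴴ = O^y`. [cite: KomaTasaki1993, §2 (2.3)] -/
theorem halfTurnY_conj_stagSpin_one {V : Type*} [Fintype V] [DecidableEq V] (σ : V → ℕ) :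
    halfTurnY n * stagSpin n σ 1 * (halfTurnY n)ᴴ = (stagSpin n σ 1 : Op V (n + 1)) := by
  rw [stagSpin, Finset.mul_sum, Finset.sum_mul]
  refine Finset.sum_congr rfl fun x _ => ?_
  rw [Matrix.mul_smul, Matrix.smul_mul, halfTurnY_conj_siteSpin_one]

/-- The half turn about the `y`-axis is a symmetry of the Hamiltonian sourced along `y`: `U (H − BO^y) Uᴴ = H − BO^y`.
[cite: KomaTasaki1993, §2 (2.3)] -/
theorem halfTurnY_conj_sourcedAF_one (J Δ B : ℝ) :
    halfTurnY n * sourcedAF d L n J Δ 1 B * (halfTurnY n)ᴴ = sourcedAF d L n J Δ 1 B := by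
  rw [sourcedAF, Matrix.mul_sub, Matrix.sub_mul, Matrix.mul_smul, Matrix.smul_mul, halfTurnY_conj_xxzHamiltonian,
    halfTurnY_conj_stagSpin_one]

/-- **No `x`-magnetisation in the `y`-sourced Gibbs state**: `⟨S^x_z⟩_{β, H − BO^y} = 0` (the half turn about `y`
fixes `H − BO^y` and reverses `S^x`). [cite: KomaTasaki1993, §2 (2.3)–(2.5)] -/
theorem gibbsState_sourcedAF_one_siteSpin_zero (J Δ β B : ℝ) (z : TorusSite d L) :
    gibbsState β (sourcedAF d L n J Δ 1 B) (siteSpin n z 0) = 0 := by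
  have h := gibbsState_conj_of_symmetry β (halfTurnY_conjTranspose_mul n) (halfTurnY_mul_conjTranspose n)
    (halfTurnY_conj_sourcedAF_one (L := L) n J Δ B) (siteSpin n z 0)
  rw [halfTurnY_conj_siteSpin_zero, map_neg] at h
  linear_combination (-(1 : ℂ) / 2) * h

end Torus

/-! ### Passing sourced torus rows to the infinitesimal-field states -/

section Thermal

variable {n : ℕ} {J : ℝ} {α : Fin 3} {β : ℝ} {ω : InfVolState d (n + 1)}

open scoped Matrix.Norms.L2Operator in
/-- **Transfer of a linear row.**  For local observables `P, Q, D ∈ 𝔄_{Λ'}`: if on every even torus into which `Λ'`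
is pulled injectively the Gibbs state `t = ⟨·⟩_{β, H − BO^α}` satisfies `Re t(ΓP) ≤ Re t(ΓQ) − B·Re t(ΓD)`, then
`Re ω(P) ≤ Re ω(Q)` for every infinitesimal-field thermal state `ω` (limit along the tori at fixed `B`, then
`B_m ↓ 0` using `|ω_m(D)| ≤ ‖D‖`). [cite: BratteliRobinsonII1997, §6.2.2] [cite: KomaTasaki1993, §1 (1.8)] -/
theorem IsInfinitesimalFieldThermalState.re_expect_le_of_torus_rows {Δ : ℝ}
    (h : IsInfinitesimalFieldThermalState d n J Δ α β ω) {Λ' : Finset (Site d)} (P Q D : Op ↥Λ' (n + 1))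
    (hrow : ∀ (B : ℝ) (k : ℕ) (h' : Set.InjOn (Torus.proj (d := d) (2 * k + 2)) ↑Λ'),
      (gibbsState β (sourcedAF d (2 * k + 2) n J Δ α B) (spinEmbed (spinToTorusEmb (2 * k + 2) h') P)).re ≤
        (gibbsState β (sourcedAF d (2 * k + 2) n J Δ α B) (spinEmbed (spinToTorusEmb (2 * k + 2) h') Q)).re -
          B * (gibbsState β (sourcedAF d (2 * k + 2) n J Δ α B) (spinEmbed (spinToTorusEmb (2 * k + 2) h') D)).re) :
    (ω.expect Λ' P).re ≤ (ω.expect Λ' Q).re := by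
  obtain ⟨B, ωB, -, hB0, hωB, hlim⟩ := h
  -- Step A: at each fixed source `B_m`, along the tori
  have hstep : ∀ m : ℕ, ((ωB m).expect Λ' P).re ≤ ((ωB m).expect Λ' Q).re - B m * ((ωB m).expect Λ' D).re := by
    intro m
    obtain ⟨κ, hκ, hω⟩ := hωB m
    refine le_of_tendsto_of_tendsto (hω.tendsto_re Λ' P)
      ((hω.tendsto_re Λ' Q).sub ((hω.tendsto_re Λ' D).const_mul (B m))) ?_
    filter_upwards [eventually_injOn_proj_of_tendsto Λ' (tendsto_two_mul_add_two hκ)] with j hj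
    rw [torusSpinExpect_of_injOn hj, torusSpinExpect_of_injOn hj, torusSpinExpect_of_injOn hj]
    exact hrow (B m) (κ j) hj
  -- Step B: `m → ∞`, the source term `B_m ω_m(D)` disappears
  have hbd : ∀ m, ‖(ωB m).expect Λ' D‖ ≤ ‖D‖ := fun m => (ωB m).norm_expect_le_holds Λ' D
  have hBD : Tendsto (fun m => B m * ((ωB m).expect Λ' D).re) atTop (𝓝 0) := by
    refine squeeze_zero_norm (a := fun m => ‖B m‖ * ‖D‖) (fun m => ?_) ?_
    · rw [norm_mul]
      exact mul_le_mul_of_nonneg_left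
        ((Real.norm_eq_abs _).le.trans ((Complex.abs_re_le_norm _).trans (hbd m))) (norm_nonneg _)
    · simpa using hB0.norm.mul_const ‖D‖
  have hP : Tendsto (fun m => ((ωB m).expect Λ' P).re) atTop (𝓝 (ω.expect Λ' P).re) :=
    (Complex.continuous_re.tendsto _).comp (hlim Λ' P)
  have hQ : Tendsto (fun m => ((ωB m).expect Λ' Q).re - B m * ((ωB m).expect Λ' D).re) atTop
      (𝓝 ((ω.expect Λ' Q).re - 0)) :=
    ((Complex.continuous_re.tendsto _).comp (hlim Λ' Q)).sub hBD
  rw [sub_zero] at hQ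
  exact le_of_tendsto_of_tendsto' hP hQ hstep

/-- **No `x`-magnetisation in the infinitesimal-field state sourced along `y`**: `ω̃(S^x_x) = 0` at every site
(any `Δ`, `β`). [cite: KomaTasaki1993, §2 (2.3)–(2.5), §1 (1.8)] -/
theorem IsInfinitesimalFieldThermalState.expect_siteSpinAt_zero_eq_zero {Δ : ℝ}
    (h : IsInfinitesimalFieldThermalState d n J Δ 1 β ω) (x : Site d) :
    ω.expect {x} (siteSpinAt n x 0) = 0 := by
  obtain ⟨B, ωB, -, -, hωB, hlim⟩ := h
  have hm : ∀ m, (ωB m).expect {x} (siteSpinAt n x 0) = 0 := by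
    intro m
    obtain ⟨κ, -, hω⟩ := hωB m
    have ht : Tendsto (fun _ : ℕ => (0 : ℂ)) atTop
        (𝓝 ((ωB m).expect {x} (onSite ⟨x, mem_singleton_self x⟩ (spinVec n 0)))) := by
      refine (hω.tendsto_onSite x (spinVec n 0)).congr fun j => ?_
      exact gibbsState_sourcedAF_one_siteSpin_zero n J Δ β (B m) (Torus.proj (2 * κ j + 2) x)
    exact tendsto_nhds_unique ht tendsto_const_nhds
  have hl := hlim {x} (siteSpinAt n x 0)
  rw [show (fun m => (ωB m).expect {x} (siteSpinAt n x 0)) = fun _ => (0 : ℂ) from funext hm] at hl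
  exact tendsto_nhds_unique hl tendsto_const_nhds

/-! ### The EEB, stationarity and reality rows of the infinitesimal-field thermal states (`Δ = 1`) -/

/-- **THE TANGENT ENERGY–ENTROPY BALANCE ROWS** (Fawzi–Fawzi–Scalet Thm. 3.1 (5) linearised; Bratteli–Robinson II
Thm. 5.3.15): for the Heisenberg antiferromagnet on `ℤ^d` (any `d, n, J`, source direction `α`, real `β`), every
infinitesimal-field thermal state `ω̃`, every finite `Λ`, `A ∈ 𝔄_Λ` (`Ã = A ⊗ 𝟙 ∈ 𝔄_{Λ_1}`, `Λ_1 = thicken Λ 1`,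
`H_{Λ_1}` the local Hamiltonian of `heisenbergLatticeInteraction d n J`) and real `θ`:
`θ·Re ω̃(ÃᴴÃ) − e^{θ−1}·Re ω̃(ÃÃᴴ) ≤ β·Re ω̃(Ãᴴ(H_{Λ_1}Ã − ÃH_{Λ_1}))`.
[cite: FawziFawziScalet2024, Thm. 3.1 (5)] [cite: BratteliRobinsonII1997, Thm. 5.3.15] -/
theorem IsInfinitesimalFieldThermalState.eeb_tangent_le (h : IsInfinitesimalFieldThermalState d n J 1 α β ω)
    (Λ : Finset (Site d)) (A : Op ↥Λ (n + 1)) (θ : ℝ) :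
    θ * (ω.expect (thicken Λ 1) ((embedOp (subset_thicken Λ 1) A)ᴴ * embedOp (subset_thicken Λ 1) A)).re -
        Real.exp (θ - 1) *
          (ω.expect (thicken Λ 1) (embedOp (subset_thicken Λ 1) A * (embedOp (subset_thicken Λ 1) A)ᴴ)).re ≤
      β * (ω.expect (thicken Λ 1) ((embedOp (subset_thicken Λ 1) A)ᴴ *
        (localHamiltonian ((heisenbergLatticeInteraction d n J).restrict (thicken Λ 1)) univ *
            embedOp (subset_thicken Λ 1) A -
          embedOp (subset_thicken Λ 1) A *
            localHamiltonian ((heisenbergLatticeInteraction d n J).restrict (thicken Λ 1)) univ))).re := by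
  set Λ' := thicken Λ (1 : ℝ) with hΛ'
  set At : Op ↥Λ' (n + 1) := embedOp (subset_thicken Λ 1) A with hAt
  set H' : Op ↥Λ' (n + 1) := localHamiltonian ((heisenbergLatticeInteraction d n J).restrict Λ') univ with hH'
  set C : Op ↥Λ' (n + 1) := Atᴴ * (H' * At - At * H') with hC
  set D : Op ↥Λ' (n + 1) :=
    Atᴴ * ∑ y : ↥Λ', (latticeStagger (y : Site d) : ℂ) • (siteSpin n y α * At - At * siteSpin n y α) with hD
  set P : Op ↥Λ' (n + 1) := ((θ : ℝ) : ℂ) • (Atᴴ * At) - ((Real.exp (θ - 1) : ℝ) : ℂ) • (At * Atᴴ) with hP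
  set Q : Op ↥Λ' (n + 1) := ((β : ℝ) : ℂ) • C with hQ
  have hmain := h.re_expect_le_of_torus_rows P Q (((β : ℝ) : ℂ) • D) fun B k h' => by
    have hk : Even (2 * k + 2) := ⟨k + 1, by ring⟩
    set X := spinEmbed (spinToTorusEmb (2 * k + 2) h') At with hX
    have hKh : (sourcedAF d (2 * k + 2) n J 1 α B).IsHermitian := sourcedAF_isHermitian n J 1 α B
    have hrow := hKh.eeb_tangent_le β θ X
    have hXX : Xᴴ * X = spinEmbed (spinToTorusEmb (2 * k + 2) h') (Atᴴ * At) := by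
      rw [hX, map_mul, spinEmbed_conjTranspose]
    have hXX' : X * Xᴴ = spinEmbed (spinToTorusEmb (2 * k + 2) h') (At * Atᴴ) := by
      rw [hX, map_mul, spinEmbed_conjTranspose]
    have hcomm : sourcedAF d (2 * k + 2) n J 1 α B * X - X * sourcedAF d (2 * k + 2) n J 1 α B =
        spinEmbed (spinToTorusEmb (2 * k + 2) h') (H' * At - At * H') -
          (B : ℂ) • spinEmbed (spinToTorusEmb (2 * k + 2) h')
            (∑ y : ↥Λ', (latticeStagger (y : Site d) : ℂ) • (siteSpin n y α * At - At * siteSpin n y α)) :=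
      sourcedAF_commutator_spinEmbed hk J α B h' A
    have hXC : Xᴴ * (sourcedAF d (2 * k + 2) n J 1 α B * X - X * sourcedAF d (2 * k + 2) n J 1 α B) =
        spinEmbed (spinToTorusEmb (2 * k + 2) h') C - (B : ℂ) • spinEmbed (spinToTorusEmb (2 * k + 2) h') D := by
      rw [hcomm, Matrix.mul_sub, Matrix.mul_smul, hX, ← spinEmbed_conjTranspose, ← map_mul, ← map_mul]
    rw [hXX, hXX', hXC] at hrow
    simp only [map_sub, map_smul, smul_eq_mul, Complex.sub_re, Complex.re_ofReal_mul] at hrow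
    simp only [hP, hQ, map_sub, map_smul, smul_eq_mul, Complex.sub_re, Complex.re_ofReal_mul]
    linarith
  simp only [hP, hQ, map_sub, map_smul, smul_eq_mul, Complex.sub_re, Complex.re_ofReal_mul] at hmain
  exact hmain

/-- **THE STATIONARITY ROWS**: `ω̃(H_{Λ_1}Ã − ÃH_{Λ_1}) = 0` for every local `A` (Fawzi–Fawzi–Scalet Thm. 3.1 (4): the
sourced Gibbs states are stationary for `K_L`, and the source contributes `B·ω_B(D₀) → 0`).
[cite: FawziFawziScalet2024, Thm. 3.1 (4)] [cite: BratteliRobinsonII1997, Thm. 5.3.15] -/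
theorem IsInfinitesimalFieldThermalState.expect_commutator_eq_zero (h : IsInfinitesimalFieldThermalState d n J 1 α β ω)
    (Λ : Finset (Site d)) (A : Op ↥Λ (n + 1)) :
    ω.expect (thicken Λ 1)
        (localHamiltonian ((heisenbergLatticeInteraction d n J).restrict (thicken Λ 1)) univ *
            embedOp (subset_thicken Λ 1) A -
          embedOp (subset_thicken Λ 1) A *
            localHamiltonian ((heisenbergLatticeInteraction d n J).restrict (thicken Λ 1)) univ) = 0 := by
  set Λ' := thicken Λ (1 : ℝ) with hΛ'
  set At : Op ↥Λ' (n + 1) := embedOp (subset_thicken Λ 1) A with hAt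
  set H' : Op ↥Λ' (n + 1) := localHamiltonian ((heisenbergLatticeInteraction d n J).restrict Λ') univ with hH'
  set C₀ : Op ↥Λ' (n + 1) := H' * At - At * H' with hC₀
  set D₀ : Op ↥Λ' (n + 1) :=
    ∑ y : ↥Λ', (latticeStagger (y : Site d) : ℂ) • (siteSpin n y α * At - At * siteSpin n y α) with hD₀
  -- finite volume: `t(Γ C₀) − B t(Γ D₀) = t([K_L, X]) = 0`
  have hfin : ∀ (B : ℝ) (k : ℕ) (h' : Set.InjOn (Torus.proj (d := d) (2 * k + 2)) ↑Λ'),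
      gibbsState β (sourcedAF d (2 * k + 2) n J 1 α B) (spinEmbed (spinToTorusEmb (2 * k + 2) h') C₀) -
        (B : ℂ) * gibbsState β (sourcedAF d (2 * k + 2) n J 1 α B) (spinEmbed (spinToTorusEmb (2 * k + 2) h') D₀) =
          0 := by
    intro B k h'
    have hk : Even (2 * k + 2) := ⟨k + 1, by ring⟩
    have hcomm : sourcedAF d (2 * k + 2) n J 1 α B * spinEmbed (spinToTorusEmb (2 * k + 2) h') At -
        spinEmbed (spinToTorusEmb (2 * k + 2) h') At * sourcedAF d (2 * k + 2) n J 1 α B =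
        spinEmbed (spinToTorusEmb (2 * k + 2) h') C₀ - (B : ℂ) • spinEmbed (spinToTorusEmb (2 * k + 2) h') D₀ :=
      sourcedAF_commutator_spinEmbed hk J α B h' A
    have h0 := Matrix.gibbsState_commutator_eq_zero β (sourcedAF d (2 * k + 2) n J 1 α B)
      (spinEmbed (spinToTorusEmb (2 * k + 2) h') At)
    rw [hcomm, map_sub, map_smul, smul_eq_mul] at h0
    exact h0
  -- transfer `Re ω(s • C₀) ≤ 0` for the four units `s = ±1, ±i`
  have hre : ∀ s : ℂ, (ω.expect Λ' (s • C₀)).re ≤ (ω.expect Λ' 0).re := by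
    intro s
    refine h.re_expect_le_of_torus_rows (s • C₀) 0 (-(s • D₀)) fun B k h' => ?_
    have h1 : s * gibbsState β (sourcedAF d (2 * k + 2) n J 1 α B) (spinEmbed (spinToTorusEmb (2 * k + 2) h') C₀) =
        (B : ℂ) * (s * gibbsState β (sourcedAF d (2 * k + 2) n J 1 α B)
          (spinEmbed (spinToTorusEmb (2 * k + 2) h') D₀)) := by
      rw [eq_of_sub_eq_zero (hfin B k h')]; ring
    simp only [map_smul, map_zero, map_neg, smul_eq_mul, Complex.zero_re, Complex.neg_re]
    rw [h1, Complex.re_ofReal_mul]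
    linarith
  have h1 := hre 1
  have h2 := hre (-1)
  have h3 := hre Complex.I
  have h4 := hre (-Complex.I)
  simp only [map_smul, map_zero, Complex.zero_re, smul_eq_mul, one_mul, neg_mul, Complex.neg_re,
    Complex.I_mul_re, neg_neg] at h1 h2 h3 h4
  apply Complex.ext
  · rw [Complex.zero_re]; linarith
  · rw [Complex.zero_im]; linarith

/-- **`(C-1)`: `ω̃(Ãᴴ[H_{Λ_1}, Ã])` IS REAL** (`ω̃(Ã⋆δÃ)` purely imaginary), as for every finite Gibbs state
(`Matrix.IsHermitian.im_gibbsState_conjTranspose_mul_commutator`); the source contributes `B·ω_B(D) → 0`.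
[cite: ArakiMoriya2003, Def 6.3 (C-1)] [cite: BratteliRobinsonII1997, Thm. 5.3.15] -/
theorem IsInfinitesimalFieldThermalState.im_expect_conjTranspose_mul_commutator_eq_zero
    (h : IsInfinitesimalFieldThermalState d n J 1 α β ω) (Λ : Finset (Site d)) (A : Op ↥Λ (n + 1)) :
    (ω.expect (thicken Λ 1) ((embedOp (subset_thicken Λ 1) A)ᴴ *
        (localHamiltonian ((heisenbergLatticeInteraction d n J).restrict (thicken Λ 1)) univ *
            embedOp (subset_thicken Λ 1) A -
          embedOp (subset_thicken Λ 1) A *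
            localHamiltonian ((heisenbergLatticeInteraction d n J).restrict (thicken Λ 1)) univ))).im = 0 := by
  set Λ' := thicken Λ (1 : ℝ) with hΛ'
  set At : Op ↥Λ' (n + 1) := embedOp (subset_thicken Λ 1) A with hAt
  set H' : Op ↥Λ' (n + 1) := localHamiltonian ((heisenbergLatticeInteraction d n J).restrict Λ') univ with hH'
  set C : Op ↥Λ' (n + 1) := Atᴴ * (H' * At - At * H') with hC
  set D : Op ↥Λ' (n + 1) :=
    Atᴴ * ∑ y : ↥Λ', (latticeStagger (y : Site d) : ℂ) • (siteSpin n y α * At - At * siteSpin n y α) with hD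
  -- finite volume: `Im (t(Γ C) − B t(Γ D)) = Im t(Xᴴ[K_L, X]) = 0`
  have hfin : ∀ (B : ℝ) (k : ℕ) (h' : Set.InjOn (Torus.proj (d := d) (2 * k + 2)) ↑Λ'),
      (gibbsState β (sourcedAF d (2 * k + 2) n J 1 α B) (spinEmbed (spinToTorusEmb (2 * k + 2) h') C)).im -
        B * (gibbsState β (sourcedAF d (2 * k + 2) n J 1 α B) (spinEmbed (spinToTorusEmb (2 * k + 2) h') D)).im =
          0 := by
    intro B k h'
    have hk : Even (2 * k + 2) := ⟨k + 1, by ring⟩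
    set X := spinEmbed (spinToTorusEmb (2 * k + 2) h') At with hX
    have hcomm : sourcedAF d (2 * k + 2) n J 1 α B * X - X * sourcedAF d (2 * k + 2) n J 1 α B =
        spinEmbed (spinToTorusEmb (2 * k + 2) h') (H' * At - At * H') -
          (B : ℂ) • spinEmbed (spinToTorusEmb (2 * k + 2) h')
            (∑ y : ↥Λ', (latticeStagger (y : Site d) : ℂ) • (siteSpin n y α * At - At * siteSpin n y α)) :=
      sourcedAF_commutator_spinEmbed hk J α B h' A
    have hXC : Xᴴ * (sourcedAF d (2 * k + 2) n J 1 α B * X - X * sourcedAF d (2 * k + 2) n J 1 α B) =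
        spinEmbed (spinToTorusEmb (2 * k + 2) h') C - (B : ℂ) • spinEmbed (spinToTorusEmb (2 * k + 2) h') D := by
      rw [hcomm, Matrix.mul_sub, Matrix.mul_smul, hX, ← spinEmbed_conjTranspose, ← map_mul, ← map_mul]
    have him := (sourcedAF_isHermitian (L := 2 * k + 2) n J 1 α B).im_gibbsState_conjTranspose_mul_commutator X β
    rw [hXC, map_sub, map_smul, Complex.sub_im, smul_eq_mul, Complex.im_ofReal_mul] at him
    exact him
  -- `Im z = -Re(i z)`: transfer `Re ω(±i • C) ≤ 0`
  have hre : ∀ s : ℂ, s = Complex.I ∨ s = -Complex.I → (ω.expect Λ' (s • C)).re ≤ (ω.expect Λ' 0).re := by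
    intro s hs
    refine h.re_expect_le_of_torus_rows (s • C) 0 (-(s • D)) fun B k h' => ?_
    have h0 := hfin B k h'
    simp only [map_smul, map_zero, map_neg, smul_eq_mul, Complex.zero_re, Complex.neg_re]
    rcases hs with rfl | rfl
    · rw [Complex.I_mul_re, Complex.I_mul_re]; linarith
    · rw [neg_mul, neg_mul, Complex.neg_re, Complex.neg_re, Complex.I_mul_re, Complex.I_mul_re]; linarith
  have h3 := hre Complex.I (Or.inl rfl)
  have h4 := hre (-Complex.I) (Or.inr rfl)
  simp only [map_smul, map_zero, Complex.zero_re, smul_eq_mul, Complex.neg_re, Complex.I_mul_re, neg_mul,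
    neg_neg] at h3 h4
  linarith

/-- **THE ENERGY–ENTROPY BALANCE INEQUALITY `(C-2)`** for the infinitesimal-field thermal states (Bratteli–Robinson II
Thm. 5.3.15 / Araki–Sewell; Araki–Moriya Def. 6.3 (C-2); Fawzi–Fawzi–Scalet Thm. 3.1 (5)): with `u = Re ω̃(ÃᴴÃ)`,
`v = Re ω̃(ÃÃᴴ)`, `c = Re ω̃(Ãᴴ[H_{Λ_1}, Ã])`: `0 < u → 0 < v` (the `+∞`-clause) and `u·log(u/v) ≤ β·c` — the
supremum over `θ` of the tangent rows `eeb_tangent_le`. [cite: ArakiMoriya2003, Def 6.3 (C-2)]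
[cite: BratteliRobinsonII1997, Thm. 5.3.15] [cite: FawziFawziScalet2024, Thm. 3.1 (5)] -/
theorem IsInfinitesimalFieldThermalState.eeb_le (h : IsInfinitesimalFieldThermalState d n J 1 α β ω)
    (Λ : Finset (Site d)) (A : Op ↥Λ (n + 1)) :
    (0 < (ω.expect (thicken Λ 1) ((embedOp (subset_thicken Λ 1) A)ᴴ * embedOp (subset_thicken Λ 1) A)).re →
        0 < (ω.expect (thicken Λ 1) (embedOp (subset_thicken Λ 1) A * (embedOp (subset_thicken Λ 1) A)ᴴ)).re) ∧
      (ω.expect (thicken Λ 1) ((embedOp (subset_thicken Λ 1) A)ᴴ * embedOp (subset_thicken Λ 1) A)).re *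
          Real.log ((ω.expect (thicken Λ 1) ((embedOp (subset_thicken Λ 1) A)ᴴ * embedOp (subset_thicken Λ 1) A)).re /
            (ω.expect (thicken Λ 1) (embedOp (subset_thicken Λ 1) A * (embedOp (subset_thicken Λ 1) A)ᴴ)).re) ≤
        β * (ω.expect (thicken Λ 1) ((embedOp (subset_thicken Λ 1) A)ᴴ *
          (localHamiltonian ((heisenbergLatticeInteraction d n J).restrict (thicken Λ 1)) univ *
              embedOp (subset_thicken Λ 1) A -
            embedOp (subset_thicken Λ 1) A *
              localHamiltonian ((heisenbergLatticeInteraction d n J).restrict (thicken Λ 1)) univ))).re := by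
  have ht := h.eeb_tangent_le Λ A
  have hu0 : 0 ≤ (ω.expect (thicken Λ 1) ((embedOp (subset_thicken Λ 1) A)ᴴ * embedOp (subset_thicken Λ 1) A)).re :=
    (Complex.nonneg_iff.1 ((ω.expect_nonneg (thicken Λ 1) (embedOp (subset_thicken Λ 1) A)))).1
  have hv0 : 0 ≤ (ω.expect (thicken Λ 1) (embedOp (subset_thicken Λ 1) A * (embedOp (subset_thicken Λ 1) A)ᴴ)).re := by
    have := ω.expect_nonneg (thicken Λ 1) (embedOp (subset_thicken Λ 1) A)ᴴ
    rw [conjTranspose_conjTranspose] at this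
    exact (Complex.nonneg_iff.1 this).1
  set u := (ω.expect (thicken Λ 1) ((embedOp (subset_thicken Λ 1) A)ᴴ * embedOp (subset_thicken Λ 1) A)).re with hu
  set v := (ω.expect (thicken Λ 1) (embedOp (subset_thicken Λ 1) A * (embedOp (subset_thicken Λ 1) A)ᴴ)).re with hv
  set c := (ω.expect (thicken Λ 1) ((embedOp (subset_thicken Λ 1) A)ᴴ *
      (localHamiltonian ((heisenbergLatticeInteraction d n J).restrict (thicken Λ 1)) univ *
          embedOp (subset_thicken Λ 1) A -
        embedOp (subset_thicken Λ 1) A *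
          localHamiltonian ((heisenbergLatticeInteraction d n J).restrict (thicken Λ 1)) univ))).re with hc
  -- the `+∞`-clause: `u > 0 = v` contradicts the rows `θ u ≤ β c` (`θ → +∞`)
  have hinf : 0 < u → 0 < v := by
    intro hupos
    by_contra hvn
    have hv00 : v = 0 := le_antisymm (not_lt.1 hvn) hv0
    have h1 := ht ((β * c + 1) / u)
    rw [hv00, mul_zero, sub_zero, div_mul_cancel₀ _ hupos.ne'] at h1
    linarith
  refine ⟨hinf, ?_⟩
  rcases hu0.eq_or_lt with hu00 | hupos
  · -- `u = 0`: the left side is `0`, and `0 ≤ β c` from the rows as `θ → -∞`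
    rw [← hu00, zero_mul]
    rcases hv0.eq_or_lt with hv00 | hvpos
    · have h1 := ht 0
      rw [← hu00, ← hv00, mul_zero, mul_zero, sub_zero] at h1
      exact h1
    · refine le_of_not_gt fun hneg => ?_
      have hpos : 0 < -(β * c) / (2 * v) := div_pos (by linarith) (by linarith)
      have h1 := ht (1 + Real.log (-(β * c) / (2 * v)))
      rw [← hu00, mul_zero, zero_sub, add_sub_cancel_left, Real.exp_log hpos] at h1
      have h2 : -(β * c) / (2 * v) * v = -(β * c) / 2 := by
        field_simp
      rw [h2] at h1
      linarith
  · -- `u, v > 0`: the row at the optimal `θ = 1 + log(u/v)` is `(C-2)`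
    have hvpos := hinf hupos
    have h2 := ht (1 + Real.log (u / v))
    rwa [tangent_eq_mul_log_div hupos hvpos] at h2

/-- **THE INFINITESIMAL-FIELD THERMAL STATES OF THE HEISENBERG ANTIFERROMAGNET ARE dKMS (ENERGY–ENTROPY-BALANCE)
STATES** of the nearest-neighbour Heisenberg interaction at inverse temperature `β` (range `1`): Araki–Moriya's
`(C-1)`, `+∞`-clause and `(C-2)` for every local observable. [cite: ArakiMoriya2003, Def 6.3]
[cite: BratteliRobinsonII1997, Thm. 5.3.15] [cite: KomaTasaki1993, §1 (1.8)] -/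
theorem IsInfinitesimalFieldThermalState.isDKMSState (h : IsInfinitesimalFieldThermalState d n J 1 α β ω) :
    ω.IsDKMSState (heisenbergLatticeInteraction d n J) 1 β := by
  intro Λ A
  set Λ' := thicken Λ (1 : ℝ) with hΛ'
  set At : Op ↥Λ' (n + 1) := embedOp (subset_thicken Λ 1) A with hAt
  set H' : Op ↥Λ' (n + 1) := localHamiltonian ((heisenbergLatticeInteraction d n J).restrict Λ') univ with hH'
  set C : Op ↥Λ' (n + 1) := Atᴴ * (H' * At - At * H') with hC
  have hder : ω.expect Λ' (Atᴴ * derivation (heisenbergLatticeInteraction d n J) 1 Λ A) =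
      Complex.I * ω.expect Λ' C := by
    have : derivation (heisenbergLatticeInteraction d n J) 1 Λ A = Complex.I • (H' * At - At * H') := rfl
    rw [this, Matrix.mul_smul, map_smul, smul_eq_mul]
  have hu : ω.expect Λ' (Atᴴ * At) = ω.expect Λ (Aᴴ * A) := by
    rw [hAt, ← embedOp_conjTranspose, ← embedOp_mul, ω.compatible]
  have hv : ω.expect Λ' (At * Atᴴ) = ω.expect Λ (A * Aᴴ) := by
    rw [hAt, ← embedOp_conjTranspose, ← embedOp_mul, ω.compatible]
  have him : (ω.expect Λ' C).im = 0 := h.im_expect_conjTranspose_mul_commutator_eq_zero Λ A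
  have heeb : (0 < (ω.expect Λ' (Atᴴ * At)).re → 0 < (ω.expect Λ' (At * Atᴴ)).re) ∧
      (ω.expect Λ' (Atᴴ * At)).re * Real.log ((ω.expect Λ' (Atᴴ * At)).re / (ω.expect Λ' (At * Atᴴ)).re) ≤
        β * (ω.expect Λ' C).re := h.eeb_le Λ A
  rw [hu, hv] at heeb
  refine ⟨?_, heeb.1, ?_⟩
  · rw [hder, Complex.I_mul_re, neg_eq_zero]
    exact him
  · rw [hder, ← mul_assoc, neg_mul, Complex.I_mul_I, neg_neg, one_mul]
    exact heeb.2

/-! ### Phase transition: dKMS states with Néel order, and two distinct dKMS states, for `d ≥ 3` -/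

/-- **THERE IS AN ENERGY–ENTROPY-BALANCE (dKMS) STATE OF THE HEISENBERG ANTIFERROMAGNET ON `ℤ^d`, `d ≥ 3`, WITH NÉEL
ORDER AT LOW TEMPERATURE** (`J > 0`, `S = n/2 ≥ ½`): there is `β₀ > 0` such that for every `β ≥ β₀` there are `σ > 0`
and an infinite-volume state `ω` of the spin-`n/2` system on `ℤ^d` which (i) satisfies Araki–Moriya's differential
`β`-KMS condition for the nearest-neighbour Heisenberg interaction (`ω.IsDKMSState (heisenbergLatticeInteraction d n J)
1 β`), (ii) satisfies the stationarity rows `ω(δA) = 0` for every local `A`, (iii) is invariant under the even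
translations, and (iv) has spontaneous staggered magnetisation `(-1)^x Re ω(Sˣ_x) ≥ √3σ` at EVERY site (the same value
at every site).  [`ω` = Koma–Tasaki's infinitesimal-field state (1.8); `σ` = the Dyson–Lieb–Simon / KLS long-range
order parameter; `√3` = Koma–Tasaki Cor. 1.1.]
[cite: KomaTasaki1993, §1 Corollary 1.1 and (1.8)–(1.10)] [cite: DLS1978, Thm. 5.1] [cite: ArakiMoriya2003, Def 6.3]
[cite: BratteliRobinsonII1997, Thm. 5.3.15] -/
theorem heisenbergAF_exists_dKMSState_neelOrder (hd : 3 ≤ d) (hn : 1 ≤ n) (hJ : 0 < J) :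
    ∃ β₀ : ℝ, 0 < β₀ ∧ ∀ β : ℝ, β₀ ≤ β → ∃ σ : ℝ, 0 < σ ∧ ∃ ω : InfVolState d (n + 1),
      ω.IsDKMSState (heisenbergLatticeInteraction d n J) 1 β ∧
      (∀ (Λ : Finset (Site d)) (A : Op ↥Λ (n + 1)),
        ω.expect (thicken Λ 1) (derivation (heisenbergLatticeInteraction d n J) 1 Λ A) = 0) ∧
      (∀ v : Site d, latticeStagger v = 1 → ω.shift v = ω) ∧
      (∀ x y : Site d, latticeStagger x * (ω.expect {x} (siteSpinAt n x 0)).re =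
        latticeStagger y * (ω.expect {y} (siteSpinAt n y 0)).re) ∧
      ∀ x : Site d, Real.sqrt 3 * σ ≤ latticeStagger x * (ω.expect {x} (siteSpinAt n x 0)).re := by
  obtain ⟨β₀, hβ₀, H⟩ := heisenbergAF_infiniteVolume_spontaneousStaggeredMagnetisation hd hn hJ
  refine ⟨β₀, hβ₀, fun β hβ => ?_⟩
  obtain ⟨σ, hσ, -, hfloor⟩ := H β hβ
  obtain ⟨ω, hω⟩ := exists_isInfinitesimalFieldThermalState (d := d) (n := n) J 1 0 β
  obtain ⟨hshift, hconst⟩ := hω.shift_eq_and_stagMagnetisation_eq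
  refine ⟨σ, hσ, ω, hω.isDKMSState, fun Λ A => ?_, hshift, hconst, hfloor ω hω⟩
  have hder : derivation (heisenbergLatticeInteraction d n J) 1 Λ A = Complex.I •
      (localHamiltonian ((heisenbergLatticeInteraction d n J).restrict (thicken Λ 1)) univ *
          embedOp (subset_thicken Λ 1) A -
        embedOp (subset_thicken Λ 1) A *
          localHamiltonian ((heisenbergLatticeInteraction d n J).restrict (thicken Λ 1)) univ) := rfl
  rw [hder, map_smul, hω.expect_commutator_eq_zero Λ A, smul_zero]

/-- **NON-UNIQUENESS OF THE dKMS STATE: THE LOW-TEMPERATURE PHASE TRANSITION OF THE HEISENBERG ANTIFERROMAGNET IN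
`d ≥ 3`.**  For `J > 0`, `S = n/2 ≥ ½`, `d ≥ 3` there is `β₀ > 0` such that for every `β ≥ β₀` the nearest-neighbour
Heisenberg interaction on `ℤ^d` has (at least) two distinct dKMS states at inverse temperature `β`: the
infinitesimal-field state sourced along `S^x` has `(-1)^x Re ω₀(Sˣ_x) ≥ √3σ > 0`, the one sourced along `S^y` has
`ω₁(Sˣ_x) = 0`.  [Dyson–Lieb–Simon's Néel order ⇒ coexistence of equilibrium states; the equilibrium notion is
Araki–Moriya's differential KMS condition, equivalent to KMS by Bratteli–Robinson II Thm. 5.3.15 (cited).]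
[cite: DLS1978, Thm. 5.1] [cite: KomaTasaki1993, §1 Corollary 1.1, (1.8)] [cite: ArakiMoriya2003, Def 6.3]
[cite: BratteliRobinsonII1997, Thm. 5.3.15] -/
theorem heisenbergAF_dKMSState_not_unique (hd : 3 ≤ d) (hn : 1 ≤ n) (hJ : 0 < J) :
    ∃ β₀ : ℝ, 0 < β₀ ∧ ∀ β : ℝ, β₀ ≤ β → ∃ ω₀ ω₁ : InfVolState d (n + 1),
      ω₀.IsDKMSState (heisenbergLatticeInteraction d n J) 1 β ∧
      ω₁.IsDKMSState (heisenbergLatticeInteraction d n J) 1 β ∧ ω₀ ≠ ω₁ := by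
  obtain ⟨β₀, hβ₀, H⟩ := heisenbergAF_infiniteVolume_spontaneousStaggeredMagnetisation hd hn hJ
  refine ⟨β₀, hβ₀, fun β hβ => ?_⟩
  obtain ⟨σ, hσ, -, hfloor⟩ := H β hβ
  obtain ⟨ω₀, hω₀⟩ := exists_isInfinitesimalFieldThermalState (d := d) (n := n) J 1 0 β
  obtain ⟨ω₁, hω₁⟩ := exists_isInfinitesimalFieldThermalState (d := d) (n := n) J 1 1 β
  refine ⟨ω₀, ω₁, hω₀.isDKMSState, hω₁.isDKMSState, fun heq => ?_⟩
  have h0 := hfloor ω₀ hω₀ 0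
  rw [heq, hω₁.expect_siteSpinAt_zero_eq_zero 0, Complex.zero_re, mul_zero] at h0
  have h3 : 0 < Real.sqrt 3 * σ := mul_pos (Real.sqrt_pos.2 (by norm_num)) hσ
  linarith

end Thermal

end XXZKT

end Literature.MathematicalPhysics.QuantumLattice

end
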